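import Summits.ABC.IUTFork.Repair.CandJoshi24
import Summits.ABC.IUTFork.Repair.EvalScalProfile
import HarnessLib

/-!
# IUT REPAIR — cross-checker: the KUMMER-IMAGE rows of §A on abc-iut-rp-j2's VALUE CHART «VAL(U)» for EVERY scalar group U (abc-iut-rp-cx gen 2)

Seat abc-iut-rp-cx (gen 2), rung LADDER-ABC:A2.RP; PROOF-ONLY (no `def`). abc-iut-rp-j2 gen 3's `Repair.CandJoshi24` makes the
indeterminacy scalar group `U ≤ ℚˣ` of the door-(a) value chart a PARAMETER (typed Thm. 3.11 for every `U`; the schema «S ⟺ ¼ ∈ U,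
Step (x) ⟺ U = ⊥» is its announced sequel). THIS FILE records the half of cx's §A split that does NOT depend on `U`: the KUMMER-IMAGE rows
are false for every `U`, because the chart's Kummer images are exactly j²-scaled (`valU_thetaRegion_logvol`: `μ(H_{j²}) = j²·μ(H_1)`) and
the q-volume is negative (`valU_qLocal_neg`) — no indeterminacy enters these two facts.
* RP-X04a `CandExplicit4.H` ✗ ∀U (`x04_false_valU`: at the label `2` the point `v = 1` of the q-image `H_1` is not in `H_4`);
* RP-C01 `VolumeTransport` ✗ ∀U (`volumeTransport_false_valU`, via cx's `EvalScalProfile.volumeTransport_false_of_scaledImages`).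
READING (neutral): on VAL(U) the Kummer-image rows are (Ind)-BLIND, as on SCAL₀ / VAL / K; the possible-image rows (L01, M32b, J02) are
the `U`-dependent ones (they follow S, i.e. the sequel's `¼ ∈ U`). No side taken on [IUTchIII] Cor. 3.12 or on any author (S. Mochizuki,
Scholze–Stix, K. Joshi); candidates are hypotheses; model data ≠ intended objects; typed ≠ proved.
-/

noncomputable section

namespace Summit.ABC.IUTFork.Repair.EvalValUProfile

open Set Thm311 Cor312 Cor312.Checks Cor312.IdentifiedNonVacuity Cor312Vol Cor312Vol.NaiveWitness Cor312Vol.PinnedWitness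
  Literature.IUT.LogThetaLattice ScalarShells Summit.ABC.IUTFork.Repair.CandJoshi24

variable (p : ℕ) [hp : Fact p.Prime] (U : Subgroup ℚˣ)

omit hp in
/-- The local q-volume of the chart: `μ(H_1) = −log p` at every label of `𝔽_l^⋇`. [folklore] -/
theorem valU_qLocal (i : Fin toyIndex.lstar) (vQ : toyIndex.VQ) : (uSetting p U).qLocal (Setting.labelSucc i) vQ = -Real.log p := by
  show uVol p U _ vQ ((uSetting p U).qRegion (Setting.labelSucc i) vQ) = _
  rw [uSetting_qRegion, if_neg (Setting.labelSucc_ne_zero i), uVol_uHalf]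
  push_cast; ring

/-- … which is negative. [folklore] -/
theorem valU_qLocal_neg (i : Fin toyIndex.lstar) (vQ : toyIndex.VQ) : (uSetting p U).qLocal (Setting.labelSucc i) vQ < 0 := by
  rw [valU_qLocal]; exact neg_neg_of_pos (log_p_pos p)

omit hp in
/-- **Exact j²-scaling of EVERY Kummer image, for every `U`**: `μ(H_{j²}) = −j²·log p = j²·μ(H_1)`. [folklore] -/
theorem valU_thetaRegion_logvol (m : ℤ) (i : Fin toyIndex.lstar) (vQ : toyIndex.VQ) :
    ((uFull p U).toLatticeSituation.D (uSetting p U).n).logvol _ vQ ((uSetting p U).thetaRegion m (Setting.labelSucc i) vQ) =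
      (((i : ℕ) + 1 : ℕ) : ℝ) ^ 2 * (uSetting p U).qLocal (Setting.labelSucc i) vQ := by
  show uVol p U _ vQ ((uSetting p U).thetaRegion m (Setting.labelSucc i) vQ) = _
  rw [uSetting_thetaRegion, uVol_uHalf, valU_qLocal]
  unfold jsq Setting.labelSucc
  rw [Fin.val_succ]; push_cast; ring

omit hp in
/-- **RP-X04a ✗ on VAL(U), every `U`**: at the label `2` the q-image `H_1` contains the point `v = 1`, which is not in the (Ind3)-Θ-region `H_4`.
[folklore] -/
theorem x04_false_valU : ¬ CandExplicit4.H (uFull p U).toLatticeSituation (uSetting p U) := fun h => by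
  have h2 := h (Setting.labelSucc (T := toyIndex) ⟨1, by decide⟩) ()
  rw [uSetting_qRegion, if_neg (Setting.labelSucc_ne_zero _), uSetting_thetaRegion3] at h2
  have h4 : jsq (Setting.labelSucc (T := toyIndex) ⟨1, by decide⟩) = 4 := by decide
  have hmem := h2 (uPt_mem_uHalf p U _ () 1)
  rw [mem_uHalf, line_uPt, h4] at hmem
  norm_num at hmem

/-- **RP-C01 `VolumeTransport` ✗ on VAL(U), every `U`** (cx's general lemma at the label `2`). [folklore] -/
theorem volumeTransport_false_valU : ¬ VolumeTransport (uSetting p U) :=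
  EvalScalProfile.volumeTransport_false_of_scaledImages (uFull p U).toLatticeSituation (uSetting p U) ⟨1, by decide⟩ le_rfl ()
    (fun m => valU_thetaRegion_logvol p U m ⟨1, by decide⟩ ()) (valU_qLocal_neg p U ⟨1, by decide⟩ ())

/-- **The Kummer-image half of §A on VAL(U), packaged**: exact j² on every Kummer image ∧ negative q-volume ∧ X04a ✗ ∧ VT ✗ — for every `U`.
[folklore] -/
theorem valU_kummerImage_rows :
    (∀ (m : ℤ) (i : Fin toyIndex.lstar) (vQ : toyIndex.VQ),
        ((uFull p U).toLatticeSituation.D (uSetting p U).n).logvol _ vQ ((uSetting p U).thetaRegion m (Setting.labelSucc i) vQ) =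
          (((i : ℕ) + 1 : ℕ) : ℝ) ^ 2 * (uSetting p U).qLocal (Setting.labelSucc i) vQ) ∧
      (∀ (i : Fin toyIndex.lstar) (vQ : toyIndex.VQ), (uSetting p U).qLocal (Setting.labelSucc i) vQ < 0) ∧
      ¬ CandExplicit4.H (uFull p U).toLatticeSituation (uSetting p U) ∧ ¬ VolumeTransport (uSetting p U) :=
  ⟨valU_thetaRegion_logvol p U, valU_qLocal_neg p U, x04_false_valU p U, volumeTransport_false_valU p U⟩

end Summit.ABC.IUTFork.Repair.EvalValUProfile

end
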